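import Summits.SmoothPoincare4.SmoothPoincare4.Theorems.ConvexBisectionAcyclicBisectionExistsBeltPageTubeColumn
import Summits.SmoothPoincare4.SmoothPoincare4.Theorems.ConvexBisectionAcyclicBisectionExistsBaseReflectionTwisting
import Literature.Topology.FourManifolds.LefschetzHandlebody
import HarnessLib

/-!
# Gluing the boundary tube of a Lefschetz handle to the twisted page tube, II: the degree-zero condition
(node T3c-1′ `node_belt_isotopic_pushoff` of the sub-goal T3 of stub `stub_steinRealisation` (NF6), line
`modp-braid-orbits`, crux `ConvexBisection.AcyclicBisectionExists`, item stmt-SmoothPoincare4-10508;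
wave 4, worker Y1, lead c5; brick (3c)-GLUE part 2, registered sub-goal `helper_belt_pageTube_glue`)

Continuation of `…BeltPageTubeColumn.lean`.  For the `j`-th handle of a Lefschetz link (attaching circle `K`
in the page `page g c`, handle framing `ν` of page twisting `t_j = ∓1`, `IsLefschetzLink.twisting_eq`) and
Z4's page-adapted tube `Φ` around `K` (CORE and FIBRE DERIVATIVE clauses of `helper_exists_pageTube`: the
fibre derivative of `Φ` at the zero section, read in `ℝ⁴`, is `[r iK' | κ rot]`), the twisted tube
`Φ₂ = twistTube Φ σ` has fibre derivative `[r iK' | κ rot] ∘ fibreRot σ x`, so by part I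

  `ambient (ν) = c K' + a₀ r iK' + a₁ κ rot`,  `a = fibreRot σ x (A(x) e₀) = e^{2πiσt} · A e₀`,

`A` the fibre derivative of the transition `Φ₂⁻¹ ∘ (h j)♭`.  Pairing with the page frame `(iK', n)`
(`⟪K', iK'⟫ = ⟪K', n⟫ = ⟪iK', n⟫ = 0`, `⟪rot, n⟫ = ¼/‖dΦ‖² > 0` since `dw(rot) = i w`) the twisting loop of
`ν` is the image of `a` under an upper-triangular matrix with positive diagonal
(`pageTwistingLoop_attachingFraming_eq`), hence homotopic to `a` through nowhere-vanishing loops, and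
`t_j = pageTwisting = wind (e^{2πiσt} A e₀) = σ + wind (A e₀)` (`pageTwisting_eq_int_add_wind`).  With the
twist `σ := t_j` the rotation field `A e₀/‖A e₀‖` has winding number `0`, hence a smooth angle (part I,
`exists_angle_of_wind_frameCol_eq_zero`): this is the hypothesis `hang` of `helper_belt_slideToAnyTube`,
delivered with `hcore` and the sign `s` of the orientation function by `helper_belt_pageTube_glue` (§3).

Everything is proved; no named facts, no `sorry`.

## References
* A. A. Kosinski, *Differential Manifolds*, Academic Press (1993), III (3.1), (3.5). [Kosinski1993]
* R. E. Gompf, A. I. Stipsicz, *4-Manifolds and Kirby Calculus* (1999), §4.5, §8.2. [GompfStipsicz1999]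
-/

noncomputable section

-- the prescribed namespace `Summit.<P>.<Sub>.…` duplicates `SmoothPoincare4` (P = Sub)
set_option linter.dupNamespace false

open scoped Manifold ContDiff Topology
open Set Function Metric Filter Complex

namespace Summit.SmoothPoincare4.SmoothPoincare4.Theorems.AcyclicBisectionExists.ModpBraidOrbits

open Literature.Topology.FourManifolds Literature.Topology.FourManifolds.LefschetzBase
  Literature.Topology.FourManifolds.HandleAttachingMap Literature.Geometry.Symplectic
  Literature.Topology.PlaneTopology

/-! ### §1 The twisting loop of the handle framing through the twisted page tube -/

section Loop

variable {g : ℕ} {c : ℂ} (f : HandleAttachingMap 3 2 (Base g)) (hc : ‖c‖ = 1)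
  (hKc : ∀ θ, f.attachingCircle θ ∈ page g c) {κ r : ℝ} (hκ : 0 < κ) (hr : 0 < r)
  {Φ : CircleTube (bBase g).carrier} (hΦcore : ∀ ψ, (bBase g).incl (Φ.core ψ) = f.attachingCircle ψ)
  (hΦder : ∀ t : ℝ, HasFDerivAt (fun v : EuclideanSpace ℝ (Fin 2) =>
      ((bBase g).incl (Φ.toHomeo (circlePt t, v))).1)
    ((EuclideanSpace.proj (𝕜 := ℝ) (0 : Fin 2)).smulRight (r • cplxJ (deriv (ambCurve g f.attachingCircle) t)) +
      (EuclideanSpace.proj (𝕜 := ℝ) (1 : Fin 2)).smulRight (κ • rotField g (f.attachingCircle (circlePt t)).1)) 0)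
  (σ : ℝ) (hσ : σ ^ 2 = 1)

/-- `w ≠ 0` at the points of a page of unit direction. [folklore] -/
theorem w_ne_zero_of_mem_page {q : Base g} (hq : q ∈ page g c) (hc : ‖c‖ = 1) : w g q.1 ≠ 0 := by
  rw [hq.2]
  intro h0
  have : c = 0 := by linear_combination 2 * h0
  rw [this, norm_zero] at hc
  exact zero_ne_one hc

include hc hKc in
/-- **`⟪rot, n⟫ = (1/4) / ‖dΦ‖² > 0` on a page**: `dw(rot) = i w` (`fderiv_w_rotField_of_le`) and
`⟪V, n⟫ = Im (w̄ dw(V)) / ‖dΦ‖²` (`inner_horizNormal`), `‖w‖ = 1/2`. [folklore] -/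
theorem inner_rotField_horizNormal_pos (t : ℝ) :
    0 < inner ℝ (rotField g (f.attachingCircle (circlePt t)).1) (horizNormal g (ambCurve g f.attachingCircle t)) := by
  set q : EuclideanSpace ℝ (Fin 4) := (f.attachingCircle (circlePt t)).1 with hq_def
  have hq0 : q ≠ 0 := coe_ne_zero _
  have hρ : rho g q = 1 / 4 := rho_eq_of_mem_page g hc (hKc _)
  have hw : w g q = c / 2 := (hKc (circlePt t)).2
  have hN : 0 < ‖dPhiX g q‖ ^ 2 + ‖dPhiY q‖ ^ 2 :=
    lt_of_le_of_ne (by positivity) (Ne.symm (normSq_dPhi_ne_zero hq0))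
  show 0 < inner ℝ (rotField g q) (horizNormal g q)
  rw [inner_horizNormal, ← fderiv_w_apply, fderiv_w_rotField_of_le (by rw [hρ]; norm_num), hw]
  apply div_pos _ hN
  have e : (starRingEnd ℂ) (c / 2) * (Complex.I * (c / 2)) = Complex.I * (Complex.normSq (c / 2) : ℂ) := by
    rw [Complex.normSq_eq_conj_mul_self]; ring
  rw [e]
  simp only [Complex.mul_im, Complex.I_re, Complex.I_im, zero_mul, one_mul, zero_add, Complex.ofReal_re]
  have hc0 : c / 2 ≠ 0 := by
    intro h0
    have : c = 0 := by linear_combination 2 * h0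
    rw [this, norm_zero] at hc
    exact zero_ne_one hc
  exact Complex.normSq_pos.2 hc0

include hKc in
/-- `⟪K', n⟫ = 0` and `⟪iK', n⟫ = 0` along a page curve (`dΦ(K') = 0`). [folklore] -/
theorem inner_velocity_horizNormal_eq_zero (t : ℝ) :
    inner ℝ (deriv (ambCurve g f.attachingCircle) t) (horizNormal g (ambCurve g f.attachingCircle t)) = 0 ∧
    inner ℝ (cplxJ (deriv (ambCurve g f.attachingCircle) t)) (horizNormal g (ambCurve g f.attachingCircle t)) = 0 := by
  have hKd : MDifferentiableAt (𝓡 1) (𝓡∂ 4) f.attachingCircle (circlePt t) :=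
    (isSmoothEmbedding_attachingCircle f).contMDiff.mdifferentiableAt (by simp)
  have hT0 := dPhi_velocity_eq_zero_of_page hKc (hasDerivAt_ambCurve (g := g) hKd).differentiableAt.hasDerivAt
  constructor
  · rw [inner_horizNormal, hT0, mul_zero, Complex.zero_im, zero_div]
  · rw [inner_horizNormal, cx_cplxJ, cy_cplxJ]
    have : dPhiX g (ambCurve g f.attachingCircle t) * (Complex.I * cx (deriv (ambCurve g f.attachingCircle) t)) +
        dPhiY (ambCurve g f.attachingCircle t) * (Complex.I * cy (deriv (ambCurve g f.attachingCircle) t)) = 0 := by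
      linear_combination Complex.I * hT0
    rw [this, mul_zero, Complex.zero_im, zero_div]

include hKc hΦcore hΦder in
/-- **The twisting loop of the handle framing, read through the twisted page tube**: with
`a = fibreRot σ x (A(x) e₀)`, `x = e^{2πit}`,
`pageTwistingLoop (t) = (a₀ · r ‖K'‖² + a₁ · κ ⟪rot, iK'⟫, a₁ · κ ⟪rot, n⟫)`. [cite: Kosinski1993, III (3.1)] -/
theorem pageTwistingLoop_attachingFraming_eq (t : ℝ) :
    pageTwistingLoop g f.attachingCircle f.attachingFraming t =
      ⟨fibreRot σ (circlePt t : EuclideanSpace ℝ (Fin 2))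
            (CircleTube.frameCol f.boundaryTube (twistTube Φ σ hσ) (circlePt t)) 0 *
          (r * ‖deriv (ambCurve g f.attachingCircle) t‖ ^ 2) +
        fibreRot σ (circlePt t : EuclideanSpace ℝ (Fin 2))
            (CircleTube.frameCol f.boundaryTube (twistTube Φ σ hσ) (circlePt t)) 1 *
          (κ * inner ℝ (rotField g (f.attachingCircle (circlePt t)).1)
            (cplxJ (deriv (ambCurve g f.attachingCircle) t))),
       fibreRot σ (circlePt t : EuclideanSpace ℝ (Fin 2))
            (CircleTube.frameCol f.boundaryTube (twistTube Φ σ hσ) (circlePt t)) 1 *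
          (κ * inner ℝ (rotField g (f.attachingCircle (circlePt t)).1)
            (horizNormal g (ambCurve g f.attachingCircle t)))⟩ := by
  obtain ⟨L₂, hL₂, hder₂⟩ := hasFDerivAt_twistTube_fibre Φ σ hσ t (hΦder t)
  have hcore := boundaryTube_core_eq_twistTube f Φ hΦcore σ hσ
  obtain ⟨c₀, hc₀⟩ := exists_ambient_attachingFraming_eq f hcore t hder₂
  obtain ⟨hKn, hiKn⟩ := inner_velocity_horizNormal_eq_zero f hKc t
  set a : EuclideanSpace ℝ (Fin 2) := fibreRot σ (circlePt t : EuclideanSpace ℝ (Fin 2))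
    (CircleTube.frameCol f.boundaryTube (twistTube Φ σ hσ) (circlePt t)) with ha_def
  have hL₂a : L₂ (CircleTube.frameCol f.boundaryTube (twistTube Φ σ hσ) (circlePt t)) =
      a 0 • (r • cplxJ (deriv (ambCurve g f.attachingCircle) t)) +
        a 1 • (κ • rotField g (f.attachingCircle (circlePt t)).1) := by
    rw [hL₂]
    simp [ContinuousLinearMap.smulRight_apply, ha_def]
  have hν : ambient g (f.attachingCircle (circlePt t)) (f.attachingFraming (circlePt t)) =
      c₀ • deriv (ambCurve g f.attachingCircle) t +
        (a 0 • (r • cplxJ (deriv (ambCurve g f.attachingCircle) t)) +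
          a 1 • (κ • rotField g (f.attachingCircle (circlePt t)).1)) :=
    hc₀.trans (congrArg (fun v : EuclideanSpace ℝ (Fin 4) => c₀ • deriv (ambCurve g f.attachingCircle) t + v) hL₂a)
  apply Complex.ext
  · show inner ℝ (ambient g (f.attachingCircle (circlePt t)) (f.attachingFraming (circlePt t)))
      (cplxJ (deriv (ambCurve g f.attachingCircle) t)) =
      a 0 * (r * ‖deriv (ambCurve g f.attachingCircle) t‖ ^ 2) +
        a 1 * (κ * inner ℝ (rotField g (f.attachingCircle (circlePt t)).1) (cplxJ (deriv (ambCurve g f.attachingCircle) t)))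
    rw [hν, inner_add_left, inner_add_left, real_inner_smul_left, real_inner_smul_left, real_inner_smul_left,
      real_inner_smul_left, real_inner_smul_left, inner_cplxJ_self, inner_cplxJ_cplxJ]
    ring
  · show inner ℝ (ambient g (f.attachingCircle (circlePt t)) (f.attachingFraming (circlePt t)))
      (horizNormal g (ambCurve g f.attachingCircle t)) =
      a 1 * (κ * inner ℝ (rotField g (f.attachingCircle (circlePt t)).1) (horizNormal g (ambCurve g f.attachingCircle t)))
    rw [hν, inner_add_left, inner_add_left, real_inner_smul_left, real_inner_smul_left, real_inner_smul_left,
      real_inner_smul_left, real_inner_smul_left, hKn, hiKn]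
    ring

end Loop

/-! ### §2 Winding numbers: `pageTwisting = σ + wind (A e₀)` -/

section Winding

variable {g : ℕ}

/-- The unit complex number `cos 2πt + i m sin 2πt` (`m = ±1`) is `e^{2πimt}`. [folklore] -/
theorem mk_cos_sin_eq_exp {m : ℤ} (hm : m = 1 ∨ m = -1) (t : ℝ) :
    (⟨(circlePt t : EuclideanSpace ℝ (Fin 2)) 0, (m : ℝ) * (circlePt t : EuclideanSpace ℝ (Fin 2)) 1⟩ : ℂ) =
      Complex.exp (((2 * Real.pi * t * m : ℝ) : ℂ) * Complex.I) := by
  rw [circlePt_apply_zero, circlePt_apply_one]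
  apply Complex.ext
  · rw [Complex.exp_ofReal_mul_I_re]
    rcases hm with rfl | rfl
    · simp
    · simp [Real.cos_neg]
  · rw [Complex.exp_ofReal_mul_I_im]
    rcases hm with rfl | rfl
    · simp
    · simp [Real.sin_neg]

/-- The loop `t ↦ e^{2πimt}` (`m : ℤ`) closes up: its values at `t = 0` and `t = 1` agree. [folklore] -/
theorem exp_int_zero_eq_one (m : ℤ) :
    (fun t : ℝ => Complex.exp (((2 * Real.pi * t * m : ℝ) : ℂ) * Complex.I)) 0 =
      (fun t : ℝ => Complex.exp (((2 * Real.pi * t * m : ℝ) : ℂ) * Complex.I)) 1 := by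
  show Complex.exp (((2 * Real.pi * 0 * m : ℝ) : ℂ) * Complex.I) = Complex.exp (((2 * Real.pi * 1 * m : ℝ) : ℂ) * Complex.I)
  have e : (((2 * Real.pi * 1 * m : ℝ) : ℂ) * Complex.I) = m * (2 * Real.pi * Complex.I) := by
    push_cast; ring
  rw [e, Complex.exp_int_mul_two_pi_mul_I]
  simp

/-- **`wind (e^{2πimt}) = m`.** [folklore] -/
theorem wind_exp_int (m : ℤ) :
    wind (fun t : ℝ => Complex.exp (((2 * Real.pi * t * m : ℝ) : ℂ) * Complex.I)) = m := by
  set l : ℝ → ℂ := fun t => (((2 * Real.pi * t * m : ℝ) : ℂ) * Complex.I) with hl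
  have hlc : ContinuousOn l (Icc 0 1) := by
    have : Continuous l := (Complex.continuous_ofReal.comp (by fun_prop)).mul continuous_const
    exact this.continuousOn
  have hspec := wind_spec (f := fun t => Complex.exp (l t)) hlc (fun t _ => rfl) (exp_int_zero_eq_one m)
  apply int_eq_of_mul_two_pi_I_eq
  rw [← hspec]
  simp only [hl]
  push_cast
  ring

variable {c : ℂ} (f : HandleAttachingMap 3 2 (Base g)) (hc : ‖c‖ = 1)
  (hKc : ∀ θ, f.attachingCircle θ ∈ page g c) {κ r : ℝ} (hκ : 0 < κ) (hr : 0 < r)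
  {Φ : CircleTube (bBase g).carrier} (hΦcore : ∀ ψ, (bBase g).incl (Φ.core ψ) = f.attachingCircle ψ)
  (hΦder : ∀ t : ℝ, HasFDerivAt (fun v : EuclideanSpace ℝ (Fin 2) =>
      ((bBase g).incl (Φ.toHomeo (circlePt t, v))).1)
    ((EuclideanSpace.proj (𝕜 := ℝ) (0 : Fin 2)).smulRight (r • cplxJ (deriv (ambCurve g f.attachingCircle) t)) +
      (EuclideanSpace.proj (𝕜 := ℝ) (1 : Fin 2)).smulRight (κ • rotField g (f.attachingCircle (circlePt t)).1)) 0)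
  {m : ℤ} (hm : m = 1 ∨ m = -1)

include hc hKc hκ hr hΦcore hΦder hm in
/-- **`pageTwisting (K, ν_f) = σ + wind (A e₀)`** for the twisted page tube `twistTube Φ σ`, `σ = ∓1`: the
twisting loop is an upper-triangular positive-diagonal image of `fibreRot σ x (A e₀) = e^{2πiσt} · (A e₀)`
(`pageTwistingLoop_attachingFraming_eq`), homotopic to it through nowhere-vanishing loops, and
`wind (e^{2πiσt} · A e₀) = σ + wind (A e₀)`. [cite: GompfStipsicz1999, §4.5] -/
theorem pageTwisting_eq_int_add_wind (hσ : ((m : ℝ)) ^ 2 = 1) :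
    pageTwisting g f.attachingCircle f.attachingFraming = m +
      wind (fun t => toC (CircleTube.frameCol f.boundaryTube (twistTube Φ (m : ℝ) hσ) (circlePt t))) := by
  set σ : ℝ := (m : ℝ) with hσ_def
  set Φ₂ := twistTube Φ σ hσ with hΦ₂
  have hcore : ∀ θ, f.boundaryTube.core θ = Φ₂.core θ := boundaryTube_core_eq_twistTube f Φ hΦcore σ hσ
  have hK := isSmoothEmbedding_attachingCircle f
  -- the ingredients, as functions of `t`
  set F : ℝ → EuclideanSpace ℝ (Fin 2) := fun t => CircleTube.frameCol f.boundaryTube Φ₂ (circlePt t) with hF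
  set a : ℝ → EuclideanSpace ℝ (Fin 2) := fun t => fibreRot σ (circlePt t : EuclideanSpace ℝ (Fin 2)) (F t) with ha
  set T : ℝ → EuclideanSpace ℝ (Fin 4) := fun t => deriv (ambCurve g f.attachingCircle) t with hT
  set ρ : ℝ → EuclideanSpace ℝ (Fin 4) := fun t => rotField g (f.attachingCircle (circlePt t)).1 with hρ
  set n : ℝ → EuclideanSpace ℝ (Fin 4) := fun t => horizNormal g (ambCurve g f.attachingCircle t) with hn
  set α : ℝ → ℝ := fun t => r * ‖T t‖ ^ 2 with hα
  set βc : ℝ → ℝ := fun t => κ * inner ℝ (ρ t) (cplxJ (T t)) with hβ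
  set γ : ℝ → ℝ := fun t => κ * inner ℝ (ρ t) (n t) with hγ
  -- positivity and non-vanishing
  have hFne : ∀ t, F t ≠ 0 := fun t => CircleTube.frameCol_ne_zero hcore _
  have hane : ∀ t, a t ≠ 0 := fun t h0 => by
    have h1 : ‖a t‖ = ‖F t‖ := BlowDownFlat.norm_fibreRot_sphere hσ (circlePt t) (F t)
    rw [h0, norm_zero] at h1
    exact hFne t (norm_eq_zero.1 h1.symm)
  have hTne : ∀ t, T t ≠ 0 := fun t h0 => by
    have hKd : MDifferentiableAt (𝓡 1) (𝓡∂ 4) f.attachingCircle (circlePt t) := hK.contMDiff.mdifferentiableAt (by simp)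
    have h1 : deriv (ambCurve g f.attachingCircle) t = 0 := h0
    rw [deriv_ambCurve hKd] at h1
    exact knotVelocity_ne_zero hK t (injective_ambient _ (h1.trans (map_zero _).symm))
  have hαpos : ∀ t, 0 < α t := fun t => mul_pos hr (by positivity [norm_pos_iff.2 (hTne t)])
  have hγpos : ∀ t, 0 < γ t := fun t => mul_pos hκ (inner_rotField_horizNormal_pos f hc hKc t)
  -- continuity
  have hK1 : ContMDiff (𝓡 1) (𝓡∂ 4) 1 f.attachingCircle := hK.contMDiff.of_le (by simp)
  have hTc : Continuous T := (contDiff_ambCurve hK1).continuous_deriv le_rfl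
  have hKc' : Continuous fun t : ℝ => f.attachingCircle (circlePt t) := hK.contMDiff.continuous.comp continuous_circlePt
  have hρc : Continuous ρ := (contDiff_rotField g).continuous.comp (continuous_subtype_val.comp hKc')
  have hnc : Continuous n := continuous_horizNormal_coe.comp hKc'
  have hFc : Continuous F := (CircleTube.contMDiff_frameCol hcore).continuous.comp continuous_circlePt
  have hac : Continuous a :=
    (contDiff_fibreRot σ).continuous.comp ((continuous_subtype_val.comp continuous_circlePt).prodMk hFc)
  have hcoord : ∀ i : Fin 2, Continuous fun t => a t i := fun i =>
    (EuclideanSpace.proj (𝕜 := ℝ) i).continuous.comp hac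
  have hαc : Continuous α := continuous_const.mul ((continuous_norm.comp hTc).pow 2)
  have hβc' : Continuous βc := continuous_const.mul (hρc.inner (continuous_cplxJ.comp hTc))
  have hγc : Continuous γ := continuous_const.mul (hρc.inner hnc)
  -- the homotopy from the twisting loop (`s = 0`) to `toC ∘ a` (`s = 1`)
  set H : ℝ → ℝ → ℂ := fun s t =>
    ((((1 - s) * α t + s) * a t 0 + (1 - s) * βc t * a t 1 : ℝ) : ℂ) +
      ((((1 - s) * γ t + s) * a t 1 : ℝ) : ℂ) * Complex.I with hH
  have hHc : Continuous (uncurry H) := by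
    have h0 : Continuous fun p : ℝ × ℝ => a p.2 0 := (hcoord 0).comp continuous_snd
    have h1 : Continuous fun p : ℝ × ℝ => a p.2 1 := (hcoord 1).comp continuous_snd
    have hα' : Continuous fun p : ℝ × ℝ => α p.2 := hαc.comp continuous_snd
    have hβ' : Continuous fun p : ℝ × ℝ => βc p.2 := hβc'.comp continuous_snd
    have hγ' : Continuous fun p : ℝ × ℝ => γ p.2 := hγc.comp continuous_snd
    show Continuous fun p : ℝ × ℝ => H p.1 p.2
    simp only [hH]
    fun_prop
  have key : ∀ t, H 0 t = ⟨a t 0 * α t + a t 1 * βc t, a t 1 * γ t⟩ := by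
    intro t
    apply Complex.ext
    · simp [hH]; ring
    · simp [hH]; ring
  have hH0 : H 0 = pageTwistingLoop g f.attachingCircle f.attachingFraming :=
    funext fun t => (key t).trans (pageTwistingLoop_attachingFraming_eq f hKc hΦcore hΦder σ hσ t).symm
  have hH1 : H 1 = fun t => Complex.exp (((2 * Real.pi * t * m : ℝ) : ℂ) * Complex.I) * toC (F t) := by
    funext t
    rw [← mk_cos_sin_eq_exp hm, ← toC_fibreRot]
    show H 1 t = toC (a t)
    apply Complex.ext
    · simp [hH]
    · simp [hH]
  have hloop : ∀ s ∈ Icc (0 : ℝ) 1, H s 0 = H s 1 := by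
    intro s _
    have hd : deriv (ambCurve g f.attachingCircle) 1 = deriv (ambCurve g f.attachingCircle) 0 := by
      have := deriv_ambCurve_add_one (g := g) (L := f.attachingCircle) 0
      rwa [zero_add] at this
    have ham : ambCurve g f.attachingCircle 1 = ambCurve g f.attachingCircle 0 := by
      have := ambCurve_add_one (g := g) (L := f.attachingCircle) 0
      rwa [zero_add] at this
    simp only [hH, ha, hF, hT, hρ, hn, hα, hβ, hγ, circlePt_one_eq_zero, hd, ham]
  have hne : ∀ s ∈ Icc (0 : ℝ) 1, ∀ t ∈ Icc (0 : ℝ) 1, H s t ≠ 0 := by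
    intro s hs t _ h0
    have hre := congrArg Complex.re h0
    have him := congrArg Complex.im h0
    simp only [hH, Complex.add_re, Complex.ofReal_re, Complex.mul_re, Complex.I_re, Complex.I_im,
      Complex.ofReal_im, mul_zero, sub_zero, add_zero, Complex.zero_re, Complex.add_im,
      Complex.mul_im, mul_one, zero_add, Complex.zero_im] at hre him
    have hcoef1 : 0 < (1 - s) * γ t + s := by
      rcases eq_or_lt_of_le hs.2 with h1 | h1
      · rw [h1]; norm_num
      · nlinarith [hγpos t, hs.1]
    have hcoef0 : 0 < (1 - s) * α t + s := by
      rcases eq_or_lt_of_le hs.2 with h1 | h1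
      · rw [h1]; norm_num
      · nlinarith [hαpos t, hs.1]
    have ha1 : a t 1 = 0 := by
      rcases mul_eq_zero.1 him with h | h
      · exact absurd h hcoef1.ne'
      · exact h
    simp only [ha1, mul_zero, add_zero] at hre
    have ha0 : a t 0 = 0 := by
      rcases mul_eq_zero.1 hre with h | h
      · exact absurd h hcoef0.ne'
      · exact h
    apply hane t
    ext i
    fin_cases i
    · exact ha0
    · exact ha1
  have hwind := wind_eq_of_homotopy hHc.continuousOn hloop hne
  -- `wind (e^{2πiσt} · A e₀) = σ + wind (A e₀)`
  have hexp : IsNonvanishingLoop fun t : ℝ => Complex.exp (((2 * Real.pi * t * m : ℝ) : ℂ) * Complex.I) :=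
    ⟨(Complex.continuous_exp.comp ((Complex.continuous_ofReal.comp (by fun_prop)).mul continuous_const)).continuousOn,
      fun t _ => Complex.exp_ne_zero _, exp_int_zero_eq_one m⟩
  have hG : IsNonvanishingLoop fun t => toC (F t) :=
    ⟨(contDiff_toC.continuous.comp hFc).continuousOn, fun t _ h0 => hFne t (toC_eq_zero_iff.1 h0), by
      show toC (F 0) = toC (F 1); simp only [hF, circlePt_one_eq_zero]⟩
  have hmul := wind_mul hexp hG
  rw [wind_exp_int] at hmul
  show wind (pageTwistingLoop g f.attachingCircle f.attachingFraming) = _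
  rw [← hH0, hwind, hH1, hmul]
  rfl

end Winding

/-! ### §3 Registered helper: the glue hypotheses for the twisted page tube -/

/-- **Registered helper `helper_belt_pageTube_glue` (node T3c-1′ of NF6 `stub_steinRealisation`, brick
(3c)-GLUE, wave 4, lead c5).**  For a Lefschetz link `h` of word `l` over `Base g`, an index `j`, and Z4's
page-adapted tube `Φ` around `K = (h j).attachingCircle` (CORE and FIBRE DERIVATIVE clauses of
`helper_exists_pageTube` as hypotheses), twist the fibres of `Φ` by `σ = t_j := ∓1`, the page twisting of the
handle (`−1` for a positive letter, `+1` for a negative one).  Then the pair `((h j).boundaryTube, twistTube Φ σ)`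
satisfies the hypotheses of Z5's `helper_belt_slideToAnyTube` / `CircleTube.exists_diffeotopy_reflect`: the
same core, a sign `s = ±1` of the orientation function, and a smooth angle `β` of the rotation field
(`frameVec = R(β) e₀`, degree zero: `pageTwisting = t_j = σ + wind (A e₀)`).
[cite: Kosinski1993, III (3.5); GompfStipsicz1999, §8.2] -/
theorem helper_belt_pageTube_glue : ∀ (g : ℕ) (l : List ((Fin g ⊕ Fin g → ℤ) × Bool)) (h : Fin l.length → Literature.Topology.FourManifolds.HandleAttachingMap 3 2 (Literature.Topology.FourManifolds.LefschetzBase.Base g)), Literature.Topology.FourManifolds.LefschetzBase.IsLefschetzLink g l h → ∀ (j : Fin l.length) (κ r : ℝ) (Φ : Literature.Topology.FourManifolds.CircleTube (Literature.Topology.FourManifolds.LefschetzBase.bBase g).carrier), 0 < κ → 0 < r → (∀ ψ, (Literature.Topology.FourManifolds.LefschetzBase.bBase g).incl (Φ.core ψ) = (h j).attachingCircle ψ) → (∀ t : ℝ, HasFDerivAt (fun v : EuclideanSpace ℝ (Fin 2) => ((Literature.Topology.FourManifolds.LefschetzBase.bBase g).incl (Φ.toHomeo (Literature.Topology.FourManifolds.circlePt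 t, v))).1) ((EuclideanSpace.proj (𝕜 := ℝ) (0 : Fin 2)).smulRight (r • Literature.Topology.FourManifolds.LefschetzBase.cplxJ (deriv (Literature.Topology.FourManifolds.LefschetzBase.ambCurve g (h j).attachingCircle) t)) + (EuclideanSpace.proj (𝕜 := ℝ) (1 : Fin 2)).smulRight (κ • Summit.SmoothPoincare4.SmoothPoincare4.Theorems.AcyclicBisectionExists.ModpBraidOrbits.rotField g ((h j).attachingCircle (Literature.Topology.FourManifolds.circlePt t)).1)) 0) → ∀ (σ : ℝ) (hσ : σ ^ 2 = 1), σ = (if (l.get j).2 then -1 else 1) → (∀ θ, (h j).boundaryTube.core θ = (Summit.SmoothPoincare4.SmoothPoincare4.Theorems.AcyclicBisectionExists.ModpBraidOrbits.twistTube Φ σ hσ).core θ) ∧ (∃ s : ℝ, s ^ 2 = 1 ∧ ∀ x, 0 < s * Literature.Topology.FourManifolds.CircleTube.frameSign (h j).boundaryTube (Summit.SmoothPoincare4.SmoothPoincare4.Theorems.AcyclicBisectionExists.ModpBraidOrbits.twistTube Φ σ hσ) x) ∧ ∃ β : Metric.sphere (0 : EuclideanSpace ℝ (Fin 2)) 1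 → ℝ, ContMDiff (𝓡 1) 𝓘(ℝ, ℝ) ∞ β ∧ ∀ x, Literature.Topology.FourManifolds.CircleTube.frameVec (h j).boundaryTube (Summit.SmoothPoincare4.SmoothPoincare4.Theorems.AcyclicBisectionExists.ModpBraidOrbits.twistTube Φ σ hσ) x = Literature.Topology.FourManifolds.rotPlane (β x) Literature.Topology.FourManifolds.planeE0 := by
  intro g l h hlink j κ r Φ hκ hr hΦcore hΦder σ hσ hσj
  have hcore : ∀ θ, (h j).boundaryTube.core θ = (twistTube Φ σ hσ).core θ :=
    boundaryTube_core_eq_twistTube (h j) Φ hΦcore σ hσ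
  refine ⟨hcore, CircleTube.exists_frameSign hcore, ?_⟩
  set m : ℤ := (if (l.get j).2 then -1 else 1) with hm_def
  have hm : m = 1 ∨ m = -1 := by rw [hm_def]; split_ifs <;> simp
  have hσm : σ = (m : ℝ) := by rw [hσj, hm_def]; push_cast; rfl
  subst hσm
  apply exists_angle_of_wind_frameCol_eq_zero hcore
  have h1 := pageTwisting_eq_int_add_wind (h j) (norm_pageDir l.length j) (hlink.mem_page j) hκ hr hΦcore hΦder hm hσ
  have h2 : pageTwisting g (h j).attachingCircle (h j).attachingFraming = m := hlink.twisting_eq j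
  rw [h2] at h1
  have h3 := (left_eq_add.1 h1).symm
  exact h3.symm

end Summit.SmoothPoincare4.SmoothPoincare4.Theorems.AcyclicBisectionExists.ModpBraidOrbits

end
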